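import Summits.AtomisticToContinuum.Crystallization.Theses.FluxTubeKepler

/-!
# Birth skeleton — crux `FluxTubeKepler.FluxCellKepler`

Item `stmt-AtomisticToContinuum-15221` (crux, rank 2, route `FluxTubeKepler`, sub-problem
`Crystallization`). The crux `X = FluxCellKepler` is the FLUX-CELL KEPLER INEQUALITY: there are a
periodic `P₀`, a radius `R₁` and a LOCAL tail credit `τ` (a real function of the pattern of relative
positions within `R₁` of a site) such that

* (DOM) `Σ_i site₆(x)_i ≤ Σ_i τ(pattern_i)` on every finite injective configuration, and
* (KEPLER) for every `δ > 0` and `R, η > 0` some `c > 0` with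
  `c · #bad_{R,η}(x) ≤ Σ_i ((1/24) site₁₂(x)_i − (1/12) τ(pattern_i)) − N · e(P₀)` on every
  `δ`-separated finite injective configuration (`bad` = sites whose `R`-neighbourhood is not
  `η`-matched two ways with a member of the relaxed Barlow / layered family).

The two conjuncts share the witness `τ`, so `X` cannot be cut into "DOM" and "KEPLER" without
naming `τ` (by monotonicity in `τ`, "∃ τ, KEPLER" alone is already `X`). The birth cut is
TRANSVERSAL instead — it separates the three things a proof of `X` must deliver:

* `stub_periodicMinimiser` — a periodic minimiser `P₀` of the Lennard-Jones energy per particle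
  EXISTS (verbatim the shared open item `stmt-AtomisticToContinuum-0627`, `CrysPeriodicMinAttained`).
  A consequence of `X` (KEPLER on chunks of periodic `Q` forces `e(P₀) = e* = min`); open
  (stacking selection among Barlow polytypes); size L.
* `stub_defectPricedExcess` — the `τ`-FREE shadow of KEPLER, i.e. QUANTITATIVE CRYSTALLIZATION onto
  the layered family: for every `δ, R, η > 0` some `c > 0` with `c · #bad_{R,η}(x) ≤ E(x) − N · e*`
  on every `δ`-separated finite configuration, `e* = ⨅_Q e(Q)` the periodic infimum. A consequence
  of `X` (DOM + the energy identity `E = Σ_i ((1/24) site₁₂ − (1/12) site₆)` + `e(P₀) = e*`); it is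
  the Hales/Kepler content of the crux with the true (non-local) tail in place of the cell credit;
  open, XL (it is what the route's transfer step `OneCentreTable → FacetTransfer` must prove, read
  globally).
* `stub_coerciveFluxCells` — COERCIVE FLUX-CELL LOCALISATION of the tail (the Thomson / flux-tube
  content of the route, card `flux-tube-thomson-8d`): there are `R₁` and a local credit `τ` with DOM
  on all finite configurations and, for every `δ > 0`, some `θ < 1` with
  `Σ_i τ_i − Σ_i site₆,i ≤ 12 θ (E(x) − N e*)` on `δ`-separated configurations — in the card's
  Bogomolny split `E = Σ_i λ_i + 𝔖/12`, the confinement defect `𝔖 = Σ τ − Σ site₆ ≥ 0` eats at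
  most a `θ`-fraction of the excess energy, i.e. the cell functional `Σ λ` keeps a fixed fraction
  `(1 − θ)` of every configuration's excess over the crystal floor. NOT a consequence of `X` (which
  only gives `θ = 1`, useless for the assembly): it is the line's bet — with a facet-flux rule that
  tracks strain to first order, `𝔖 = O(strain⁴)` while the excess is `O(strain²)`; it fails if the
  cell functional has a soft mode the true energy lacks, or if disordered (icosahedral-rich) packings
  carry confinement defect comparable to their whole excess at every admissible flux rule. Size XL.

Assembly `FluxCellKepler_of` (real proof, no `sorry`): `P₀` from stub 1, so `e(P₀) = e*`
(`IsLeast.csInf_eq`, `sInf_range`); `(R₁, τ)` and DOM from stub 3; given `δ, R, η` take `θ` from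
stub 3 and `c` from stub 2 and put `c' := (1 − θ) c > 0`; by the energy identity
`Σ_i λ_i = E − (Σ τ − Σ site₆)/12 ≥ E − θ (E − N e*)`, hence
`Σ_i λ_i − N e(P₀) ≥ (1 − θ)(E − N e*) ≥ (1 − θ) c · #bad = c' · #bad`. The identity is proved
here (`interactionEnergy_lennardJones_eq_sum`) from `two_mul_interactionEnergy` and the definition
of `lennardJones`, so the constants `1/24`, `1/12` of the crux are certified by the kernel.
`FluxCellKepler_skeleton : FluxCellKepler` applies it to the three sorried stubs (the only `sorry`s).
-/

namespace Summit.AtomisticToContinuum.Crystallization.Cruxes.FluxCellKepler.Birth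

open scoped BigOperators
open Literature.MathematicalPhysics.StatisticalMechanics

/-! ## The three declared stubs (the only `sorry`s of the file) -/

/-- **Stub 1 — a periodic Lennard-Jones minimiser exists** (verbatim the shared open item
`stmt-AtomisticToContinuum-0627`, `CrysPeriodicMinAttained`): the infimum over periodic
configurations of `ℝ³` of the energy per particle is attained. Consequence of the crux (its `P₀` is
forced to be a minimiser); open: needs stacking selection among Barlow polytypes (Hägg domination at
the `1e-4` scale) and compactness of near-optimal periodic configurations; false iff optimal
stackings are aperiodic with unattained infimum. [conjecture] -/
theorem stub_periodicMinimiser :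
    ∃ P : PeriodicConfiguration 3,
      IsLeast (Set.range fun Q : PeriodicConfiguration 3 => Q.energyPerParticle lennardJones)
        (P.energyPerParticle lennardJones) := by
  sorry

/-- **Stub 2 — defect-priced excess energy (τ-free quantitative crystallization onto the layered
family).** For every separation `δ > 0` and every pattern test `(R, η)` there is `c > 0` such that on
every finite `δ`-separated configuration of distinct points the Lennard-Jones energy exceeds
`N · e*` (`e*` = the periodic infimum of the energy per particle) by at least `c` per site whose
`R`-neighbourhood is not two-way `η`-matched with a member of the relaxed Barlow / layered family
(spacing `a ∈ [47/50, 1]`, free Hägg word, interlayer increments in `[39a/50, 17a/20]`). The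
Kepler content of the crux with the true tail in place of the cell credit (crux ⇒ stub 2 by DOM and
the energy identity); `c(R, η)` may be as small as `μ (η/R)²` (uniform strain); false iff a
non-layered competitor (amorphous / Frank–Kasper) ties `e*` in energy density. [conjecture] -/
theorem stub_defectPricedExcess :
    ∀ δ : ℝ, 0 < δ → ∀ R η : ℝ, 0 < R → 0 < η → ∃ c : ℝ, 0 < c ∧
      ∀ (N : ℕ) (x : Fin N → EuclideanSpace ℝ (Fin 3)), Function.Injective x →
        (∀ i j, i ≠ j → δ ≤ dist (x i) (x j)) →
        c * (Nat.card {i : Fin N // ¬ ∃ a : ℝ, 47 / 50 ≤ a ∧ a ≤ 1 ∧ ∃ (A : EuclideanSpace ℝ (Fin 3) →ₗᵢ[ℝ] EuclideanSpace ℝ (Fin 3)) (s : ℤ → ℤ) (z : ℤ → ℝ), IsHaggSeq s ∧ (∀ m : ℤ, 39 / 50 * a ≤ z (m + 1) - z m ∧ z (m + 1) - z m ≤ 17 / 20 * a) ∧ let S : Set (EuclideanSpace ℝ (Fin 3)) := {p | ∃ m k l : ℤ, p = A (((k : ℝ) • triangularVec₁ a) + ((l : ℝ) • triangularVec₂ a)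 + ((haggLabel s m : ℝ) • barlowOffset a) + (z m • layerNormal 1))}; (∀ p ∈ S, ‖p‖ ≤ R → ∃ j : Fin N, dist (x j - x i) p ≤ η) ∧ (∀ j : Fin N, ‖x j - x i‖ ≤ R → ∃ p ∈ S, dist (x j - x i) p ≤ η)} : ℝ)
          ≤ interactionEnergy lennardJones x
              - (N : ℝ) * ⨅ Q : PeriodicConfiguration 3, Q.energyPerParticle lennardJones := by
  sorry

/-- **Stub 3 — coercive flux-cell localisation of the `r⁻⁶` tail** (the Thomson / flux-tube content).
There are a radius `R₁` and a LOCAL tail credit `τ` (a function of the pattern of relative positions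
within `R₁`) such that (DOM) `Σ_i site₆,i ≤ Σ_i τ(pattern_i)` on every finite injective
configuration, and (θ-SHARPNESS) for every `δ > 0` some `θ < 1` with
`Σ_i τ(pattern_i) − Σ_i site₆,i ≤ 12 θ (E(x) − N e*)` on every `δ`-separated finite injective
configuration: the over-credit (the card's confinement defect `𝔖 ≥ 0` in `E = Σ λ + 𝔖/12`) is at
most a `θ`-fraction of the excess energy. Intended `τ = 2π⁴ (T(Vor_i ∩ B(R₁/2), x_i; q) − T(ℝ³))`
(8-D flux-tube energies with a local antisymmetric facet-flux rule `q` exact on Barlow bond types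
and linear in strain), DOM = Thomson's principle; sharpness = `𝔖 = O(strain⁴)` near the layered
family and a definite margin on disordered cells. Not implied by the crux (which gives `θ = 1`);
fails if the cell functional has a soft mode the true energy lacks, or if some disordered packing
family has `𝔖 / (12 (E − N e*)) → 1` for every admissible local credit. [conjecture] -/
theorem stub_coerciveFluxCells :
    ∃ (R₁ : ℝ) (τ : Finset (EuclideanSpace ℝ (Fin 3)) → ℝ),
      (∀ (N : ℕ) (x : Fin N → EuclideanSpace ℝ (Fin 3)), Function.Injective x →
        ∑ i, siteEnergy (fun r => (r⁻¹) ^ 6) x i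
          ≤ ∑ i, τ ((Finset.univ.filter fun j : Fin N => dist (x j) (x i) ≤ R₁).image fun j => x j - x i)) ∧
      (∀ δ : ℝ, 0 < δ → ∃ θ : ℝ, θ < 1 ∧
        ∀ (N : ℕ) (x : Fin N → EuclideanSpace ℝ (Fin 3)), Function.Injective x →
          (∀ i j, i ≠ j → δ ≤ dist (x i) (x j)) →
          ∑ i, τ ((Finset.univ.filter fun j : Fin N => dist (x j) (x i) ≤ R₁).image fun j => x j - x i)
              - ∑ i, siteEnergy (fun r => (r⁻¹) ^ 6) x i
            ≤ 12 * θ * (interactionEnergy lennardJones x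
                - (N : ℝ) * ⨅ Q : PeriodicConfiguration 3, Q.energyPerParticle lennardJones)) := by
  sorry

/-! ## Assembly lemma (sorry-free): the energy identity with the crux's constants -/

/-- `E_LJ(x) = Σ_i ((1/24) site₁₂(x)_i − (1/12) site₆(x)_i)`: double counting
(`two_mul_interactionEnergy`) and `V_LJ(r) = (1/12) r⁻¹² − (1/6) r⁻⁶`. This certifies the pairing
of the constants `1/24, 1/12` in the crux with the tree's normalisation. [folklore] -/
theorem interactionEnergy_lennardJones_eq_sum {N : ℕ} (x : Fin N → EuclideanSpace ℝ (Fin 3)) :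
    interactionEnergy lennardJones x
      = ∑ i, ((1 / 24 : ℝ) * siteEnergy (fun r => (r⁻¹) ^ 12) x i
          - (1 / 12 : ℝ) * siteEnergy (fun r => (r⁻¹) ^ 6) x i) := by
  have h2 := two_mul_interactionEnergy lennardJones x
  have hsite : ∀ i : Fin N, siteEnergy lennardJones x i
      = (1 / 12 : ℝ) * siteEnergy (fun r => (r⁻¹) ^ 12) x i
          - (1 / 6 : ℝ) * siteEnergy (fun r => (r⁻¹) ^ 6) x i := by
    intro i
    simp only [siteEnergy, lennardJones, Finset.sum_sub_distrib, Finset.mul_sum]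
  rw [Finset.sum_congr rfl fun i _ => hsite i] at h2
  have hE : interactionEnergy lennardJones x
      = (1 / 2 : ℝ) * ∑ i, ((1 / 12 : ℝ) * siteEnergy (fun r => (r⁻¹) ^ 12) x i
          - (1 / 6 : ℝ) * siteEnergy (fun r => (r⁻¹) ^ 6) x i) := by
    linarith
  rw [hE, Finset.mul_sum]
  exact Finset.sum_congr rfl fun i _ => by ring

/-! ## The stub statements as named propositions (verbatim the stub signatures) -/

/-- Statement of `stub_periodicMinimiser` (verbatim; = item stmt-AtomisticToContinuum-0627).
[conjecture] -/
def Sig.stub_periodicMinimiser : Prop :=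
  ∃ P : PeriodicConfiguration 3,
      IsLeast (Set.range fun Q : PeriodicConfiguration 3 => Q.energyPerParticle lennardJones)
        (P.energyPerParticle lennardJones)

/-- Statement of `stub_defectPricedExcess` (verbatim). [conjecture] -/
def Sig.stub_defectPricedExcess : Prop :=
  ∀ δ : ℝ, 0 < δ → ∀ R η : ℝ, 0 < R → 0 < η → ∃ c : ℝ, 0 < c ∧
      ∀ (N : ℕ) (x : Fin N → EuclideanSpace ℝ (Fin 3)), Function.Injective x →
        (∀ i j, i ≠ j → δ ≤ dist (x i) (x j)) →
        c * (Nat.card {i : Fin N // ¬ ∃ a : ℝ, 47 / 50 ≤ a ∧ a ≤ 1 ∧ ∃ (A : EuclideanSpace ℝ (Fin 3) →ₗᵢ[ℝ] EuclideanSpace ℝ (Fin 3)) (s : ℤ → ℤ) (z : ℤ → ℝ), IsHaggSeq s ∧ (∀ m : ℤ, 39 / 50 * a ≤ z (m + 1) - z m ∧ z (m + 1) - z m ≤ 17 / 20 * a) ∧ let S : Set (EuclideanSpace ℝ (Fin 3)) := {p | ∃ m k l : ℤ, p = A (((k : ℝ) • triangularVec₁ a) + ((l : ℝ) • triangularVec₂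 a) + ((haggLabel s m : ℝ) • barlowOffset a) + (z m • layerNormal 1))}; (∀ p ∈ S, ‖p‖ ≤ R → ∃ j : Fin N, dist (x j - x i) p ≤ η) ∧ (∀ j : Fin N, ‖x j - x i‖ ≤ R → ∃ p ∈ S, dist (x j - x i) p ≤ η)} : ℝ)
          ≤ interactionEnergy lennardJones x
              - (N : ℝ) * ⨅ Q : PeriodicConfiguration 3, Q.energyPerParticle lennardJones

/-- Statement of `stub_coerciveFluxCells` (verbatim). [conjecture] -/
def Sig.stub_coerciveFluxCells : Prop :=
  ∃ (R₁ : ℝ) (τ : Finset (EuclideanSpace ℝ (Fin 3)) → ℝ),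
      (∀ (N : ℕ) (x : Fin N → EuclideanSpace ℝ (Fin 3)), Function.Injective x →
        ∑ i, siteEnergy (fun r => (r⁻¹) ^ 6) x i
          ≤ ∑ i, τ ((Finset.univ.filter fun j : Fin N => dist (x j) (x i) ≤ R₁).image fun j => x j - x i)) ∧
      (∀ δ : ℝ, 0 < δ → ∃ θ : ℝ, θ < 1 ∧
        ∀ (N : ℕ) (x : Fin N → EuclideanSpace ℝ (Fin 3)), Function.Injective x →
          (∀ i j, i ≠ j → δ ≤ dist (x i) (x j)) →
          ∑ i, τ ((Finset.univ.filter fun j : Fin N => dist (x j) (x i) ≤ R₁).image fun j => x j - x i)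
              - ∑ i, siteEnergy (fun r => (r⁻¹) ^ 6) x i
            ≤ 12 * θ * (interactionEnergy lennardJones x
                - (N : ℝ) * ⨅ Q : PeriodicConfiguration 3, Q.energyPerParticle lennardJones))

/-! ## The skeleton theorem: the crux BY NAME from the three stub statements (sorry-free) -/

/-- **Assembly.** `stub_periodicMinimiser → stub_defectPricedExcess → stub_coerciveFluxCells →
FluxCellKepler` (the route's crux decl, by name), sorry-free. Take the minimiser `P₀` of stub 1, so
`e(P₀) = e*`; take `(R₁, τ)` and DOM from stub 3; given `δ, R, η`, take `θ < 1` from stub 3 and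
`c > 0` from stub 2 and set `c' := (1 − θ) c`. On a `δ`-separated `x`, by the energy identity
`Σ_i ((1/24) site₁₂ − (1/12) τ_i) = E − (Σ τ − Σ site₆)/12 ≥ E − θ (E − N e*)`, so the cell sum
exceeds `N e(P₀) = N e*` by at least `(1 − θ)(E − N e*) ≥ (1 − θ) c · #bad`. [folklore] -/
theorem FluxCellKepler_of (h₁ : Sig.stub_periodicMinimiser) (h₂ : Sig.stub_defectPricedExcess)
    (h₃ : Sig.stub_coerciveFluxCells) :
    Summit.AtomisticToContinuum.Crystallization.Theses.FluxTubeKepler.FluxCellKepler := by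
  obtain ⟨P₀, hP₀⟩ := h₁
  obtain ⟨R₁, τ, hdom, hsharp⟩ := h₃
  have he : (⨅ Q : PeriodicConfiguration 3, Q.energyPerParticle lennardJones)
      = P₀.energyPerParticle lennardJones := by
    rw [← sInf_range]
    exact hP₀.csInf_eq
  refine ⟨P₀, R₁, τ, hdom, ?_⟩
  intro δ hδ R η hR hη
  obtain ⟨θ, hθ, hθb⟩ := hsharp δ hδ
  obtain ⟨c, hc, hcb⟩ := h₂ δ hδ R η hR hη
  refine ⟨(1 - θ) * c, mul_pos (sub_pos.2 hθ) hc, ?_⟩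
  intro N x hx hsep
  have hG := hcb N x hx hsep
  have hL := hθb N x hx hsep
  rw [he] at hG hL
  have hsum : ∑ i, ((1 / 24 : ℝ) * siteEnergy (fun r => (r⁻¹) ^ 12) x i
        - (1 / 12 : ℝ) * τ ((Finset.univ.filter fun j : Fin N => dist (x j) (x i) ≤ R₁).image fun j => x j - x i))
      = interactionEnergy lennardJones x
        - (1 / 12 : ℝ) * (∑ i, τ ((Finset.univ.filter fun j : Fin N => dist (x j) (x i) ≤ R₁).image fun j => x j - x i)
            - ∑ i, siteEnergy (fun r => (r⁻¹) ^ 6) x i) := by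
    rw [interactionEnergy_lennardJones_eq_sum, Finset.sum_sub_distrib, Finset.sum_sub_distrib,
      ← Finset.mul_sum, ← Finset.mul_sum, ← Finset.mul_sum]
    ring
  rw [hsum]
  have h1 : (1 - θ) * (c * (Nat.card {i : Fin N // ¬ ∃ a : ℝ, 47 / 50 ≤ a ∧ a ≤ 1 ∧ ∃ (A : EuclideanSpace ℝ (Fin 3) →ₗᵢ[ℝ] EuclideanSpace ℝ (Fin 3)) (s : ℤ → ℤ) (z : ℤ → ℝ), IsHaggSeq s ∧ (∀ m : ℤ, 39 / 50 * a ≤ z (m + 1) - z m ∧ z (m + 1) - z m ≤ 17 / 20 * a) ∧ let S : Set (EuclideanSpace ℝ (Fin 3)) := {p | ∃ m k l : ℤ, p = A (((k : ℝ) • triangularVec₁ a) + ((l : ℝ) • triangularVec₂ a) + ((haggLabel s m : ℝ) • barlowOffset a) + (z m • layerNormal 1))}; (∀ p ∈ S, ‖p‖ ≤ R → ∃ j : Fin N, dist (x j - x i) p ≤ η) ∧ (∀ j : Fin N, ‖x j - x i‖ ≤ R → ∃ p ∈ S, dist (x j - x i) p ≤ η)} : ℝ))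
      ≤ (1 - θ) * (interactionEnergy lennardJones x - (N : ℝ) * P₀.energyPerParticle lennardJones) :=
    mul_le_mul_of_nonneg_left hG (sub_nonneg.2 hθ.le)
  nlinarith [h1, hL]

/-- **The closed skeleton instance**: the crux by name from the three declared stubs (the only
place `sorry` enters). [conjecture] -/
theorem FluxCellKepler_skeleton :
    Summit.AtomisticToContinuum.Crystallization.Theses.FluxTubeKepler.FluxCellKepler :=
  FluxCellKepler_of stub_periodicMinimiser stub_defectPricedExcess stub_coerciveFluxCells

end Summit.AtomisticToContinuum.Crystallization.Cruxes.FluxCellKepler.Birth
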